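import Literature.NumberTheory.Sieve.ParityWave0OddLogChowlaGvN
import Literature.NumberTheory.Sieve.ParityWave0OddLogChowlaDefs
import Literature.NumberTheory.LFunctions.TaoLogElliottLogAvg
import HarnessLib

/-!
# Odd-order logarithmic Chowla (Tao–Teräväinen 2018): the flat sums of Theorem 3.2

Topic `Literature/NumberTheory/Sieve`; third support file towards the named fact
`Literature.NumberTheory.Sieve.liouville_logCorrelation_isLittleO_of_odd` (**parity.S22**,
`ParityWave0.lean`): T. Tao, J. Teräväinen, *Odd order cases of the logarithmically averaged
Chowla conjecture*, J. Théor. Nombres Bordeaux 30 (2018), 997–1015 (arXiv:1710.02112), §5, the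
proof of Theorem 3.2 (comparison of prime and integer dilates). Everything here is PROVED; no
definitions, no named facts.

The comparison theorem is reduced in the source ("by summation by parts, it will suffice to show
that `𝔼_{d ≤ H} f_x(a(Wd+b)) (Λ_{b,W}(d) - 1) ≪ ε`", display (targ)) to a bound for the flat sums
`∑_{d ≤ H} θ(d) f_x(a(Wd + b))` of the correlation `f_x(a) = 𝔼^{log}_{ν ≤ x} ∏_j λ(ν + a h_j)`
(`OddLogChowla.corrLogAvg`) against the weight `θ = Λ_{b,W} - 1`, and that bound is obtained by
shifting `ν` by `1 ≤ n' ≤ aHW`, averaging in `n'`, splitting `n' = aW n'' + c`, and applying the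
generalised von Neumann theorem Lemma 5.2 (`OddLogChowla.abs_sum_dilated_le`,
`ParityWave0OddLogChowlaGvN.lean`). This file proves exactly that, for an arbitrary weight `θ`:

* `OddLogChowla.abs_sum_mul_corrLogAvg_le` — for `a, W, H ≥ 1`, `b, x ∈ ℕ`, shifts `h_j ≤ B`
  with `h_{i₀} = 0`:
  `|∑_{d=1}^{H} θ(d) f_x(a(Wd + b))| ≤ (B+3)² H ‖θ‖_{U^k[H]} + 4aWH (∑_{d ≤ H} |θ(d)|) / ∑_{ν ≤ x} 1/ν`
  (the second term is the price of the shifts, `o(1)` as `x → ∞` for fixed `a, W, H`, from the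
  translation estimate of Tao 2016, Lemma 2.5, `Tao2016.norm_sum_shift_up_sub_le`).

Deviation from print: the source works on `(x^ε, x]` to make shifts cheap uniformly; for
Theorem 3.2 the whole range `[1, x]` with the cruder translation cost `4 n'` suffices because
`x` is taken large after all other parameters.

## References
* T. Tao, J. Teräväinen, J. Théor. Nombres Bordeaux 30 (2018), §5, proof of Theorem 3.2 (from
  (targ) to the end of the section). [TaoTeravainenJTNB2018]
* T. Tao, Forum Math. Pi 4 (2016), e8, Lemma 2.5 (translation invariance). [TaoFMP2016]
-/

noncomputable section

open Finset

namespace Literature.NumberTheory.Sieve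

namespace OddLogChowla

/-! ### The shift-and-average step of Theorem 3.2 -/

/-- **Translation of a logarithmic sum over `[1, x]`** (real-valued form of the tree's
`Tao2016.norm_sum_shift_up_sub_le`, Tao 2016, Lemma 2.5): for `|G| ≤ 1`,
`|∑_{ν ≤ x} G(ν + t)/ν - ∑_{ν ≤ x} G(ν)/ν| ≤ 4t`. [cite: TaoFMP2016, Lemma 2.5] -/
theorem abs_sum_Icc_shift_sub_le {G : ℕ → ℝ} (hG : ∀ n, |G n| ≤ 1) (t x : ℕ) :
    |∑ ν ∈ Icc 1 x, G (ν + t) / ν - ∑ ν ∈ Icc 1 x, G ν / ν| ≤ 4 * t := by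
  have h := Literature.NumberTheory.LFunctions.Tao2016.norm_sum_shift_up_sub_le
    (X := fun n => (G n : ℂ)) (fun n => by rw [Complex.norm_real, Real.norm_eq_abs]; exact hG n) t 0 x
  rw [← Finset.Icc_add_one_left_eq_Ioc, zero_add] at h
  have hcast : (∑ n ∈ Icc 1 x, ((G (n + t) : ℝ) : ℂ) / (n : ℂ) - ∑ n ∈ Icc 1 x, ((G n : ℝ) : ℂ) / (n : ℂ))
      = (((∑ ν ∈ Icc 1 x, G (ν + t) / ν - ∑ ν ∈ Icc 1 x, G ν / ν : ℝ)) : ℂ) := by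
    push_cast; rfl
  rw [hcast, Complex.norm_real, Real.norm_eq_abs] at h
  exact h

/-- **Averaging over shifts**: for `|G| ≤ 1` and `N ≥ 1`,
`|∑_{ν ≤ x} G(ν)/ν - (1/N) ∑_{t=1}^{N} ∑_{ν ≤ x} G(ν + t)/ν| ≤ 4N`. [cite: TaoTeravainenJTNB2018,
§5 (proof of Theorem 3.2, "we can shift `n` by any quantity `1 ≤ n' ≤ aHW`")] -/
theorem abs_sum_sub_avg_shift_le {G : ℕ → ℝ} (hG : ∀ n, |G n| ≤ 1) {N : ℕ} (hN : 1 ≤ N) (x : ℕ) :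
    |∑ ν ∈ Icc 1 x, G ν / ν - (∑ t ∈ Icc 1 N, ∑ ν ∈ Icc 1 x, G (ν + t) / ν) / N| ≤ 4 * N := by
  have hN0 : (0 : ℝ) < N := by exact_mod_cast hN
  have hcard : ((Icc 1 N).card : ℝ) = N := by simp
  have h1 : ∑ ν ∈ Icc 1 x, G ν / ν = (∑ t ∈ Icc 1 N, ∑ ν ∈ Icc 1 x, G ν / ν) / N := by
    rw [Finset.sum_const, nsmul_eq_mul, hcard, mul_div_cancel_left₀ _ hN0.ne']
  rw [h1, ← sub_div, ← Finset.sum_sub_distrib, abs_div, abs_of_pos hN0, div_le_iff₀ hN0]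
  calc |∑ t ∈ Icc 1 N, (∑ ν ∈ Icc 1 x, G ν / ν - ∑ ν ∈ Icc 1 x, G (ν + t) / ν)|
      ≤ ∑ t ∈ Icc 1 N, |∑ ν ∈ Icc 1 x, G ν / ν - ∑ ν ∈ Icc 1 x, G (ν + t) / ν| :=
        Finset.abs_sum_le_sum_abs _ _
    _ ≤ ∑ t ∈ Icc 1 N, (4 * N : ℝ) := Finset.sum_le_sum fun t ht => by
        rw [abs_sub_comm]
        refine (abs_sum_Icc_shift_sub_le hG t x).trans ?_
        have : (t : ℝ) ≤ N := by exact_mod_cast (Finset.mem_Icc.mp ht).2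
        linarith
    _ = 4 * N * N := by rw [Finset.sum_const, nsmul_eq_mul, hcard]; ring

/-- **Splitting a sum over `[1, MH]` into blocks of length `M`**:
`∑_{n=1}^{MH} f(n) = ∑_{n'' < H} ∑_{c=1}^{M} f(M n'' + c)`. [folklore] -/
theorem sum_Icc_mul_eq_sum_sum (f : ℕ → ℝ) (M H : ℕ) :
    ∑ n ∈ Icc 1 (M * H), f n = ∑ n'' ∈ Finset.range H, ∑ c ∈ Icc 1 M, f (M * n'' + c) := by
  induction H with
  | zero => simp
  | succ H ih =>
    rw [Finset.sum_range_succ, ← ih]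
    have hsplit : Icc 1 (M * (H + 1)) = Icc 1 (M * H) ∪ Ioc (M * H) (M * (H + 1)) := by
      ext n; simp only [Finset.mem_union, Finset.mem_Icc, Finset.mem_Ioc]; constructor
      · intro hn; by_cases h : n ≤ M * H
        · exact Or.inl ⟨hn.1, h⟩
        · exact Or.inr ⟨by omega, hn.2⟩
      · rintro (hn | hn)
        · exact ⟨hn.1, hn.2.trans (by nlinarith)⟩
        · exact ⟨by omega, hn.2⟩
    have hdisj : Disjoint (Icc 1 (M * H)) (Ioc (M * H) (M * (H + 1))) := by
      rw [Finset.disjoint_left]; intro n hn hn'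
      simp only [Finset.mem_Icc, Finset.mem_Ioc] at hn hn'; omega
    rw [hsplit, Finset.sum_union hdisj]
    congr 1
    have : Ioc (M * H) (M * (H + 1)) = Ico (1 + M * H) (M + 1 + M * H) := by
      ext n; simp only [Finset.mem_Ioc, Finset.mem_Ico]; constructor <;> intro h <;> constructor <;> nlinarith [h.1, h.2]
    rw [this, ← Finset.sum_Ico_add, Finset.Ico_add_one_right_eq_Icc]

/-- `∑_{n'' < H} g(n'' + 1) = ∑_{n=1}^{H} g(n)`. [folklore] -/
theorem sum_range_succ_eq_sum_Icc (g : ℕ → ℝ) (H : ℕ) :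
    ∑ n'' ∈ Finset.range H, g (n'' + 1) = ∑ n ∈ Icc 1 H, g n := by
  rw [Finset.range_eq_Ico, Finset.sum_Ico_add' g 0 H 1, zero_add, Finset.Ico_add_one_right_eq_Icc]

/-- The dilated correlation at a shifted argument, as a dilated-shift pattern in `(n'', d)`:
`g_{a(Wd+b)}(ν + aWn'' + c) = ∏_j λ(ν + c + ab h_j + aW(n'' + h_j d))`. [folklore] -/
theorem dilatedCorr_shift_eq {k : ℕ} (h : Fin k → ℕ) (a W b d ν c n'' : ℕ) :
    dilatedCorr h (a * (W * d + b)) (ν + (a * W * n'' + c)) =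
      ∏ j, (ArithmeticFunction.liouville
        (ν + c + a * b * h j + a * W * (n'' + 1 + h j * d - 1)) : ℝ) := by
  unfold dilatedCorr
  refine Finset.prod_congr rfl fun j _ => ?_
  have : n'' + 1 + h j * d - 1 = n'' + h j * d := by omega
  rw [this]
  congr 2
  ring

/-- **The flat sum of Theorem 3.2** (Tao–Teräväinen 2018, §5, proof of Theorem 3.2 from (targ)
on: shift `n` by `1 ≤ n' ≤ aHW` and average, split `n' = aW n'' + c`, apply Lemma 5.2): for any
weight `θ : ℕ → ℝ`, `a, W, H ≥ 1`, `b, x ∈ ℕ` and shifts `h_j ≤ B` with `h_{i₀} = 0`,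
`|∑_{d=1}^{H} θ(d) f_x(a(Wd + b))| ≤ (B+3)² H ‖θ‖_{U^k[H]} + 4 aWH (∑_{d ≤ H} |θ(d)|) / ∑_{ν ≤ x} 1/ν`,
where `f_x(a) = 𝔼^{log}_{ν ≤ x} ∏_j λ(ν + a h_j)` (`corrLogAvg`). Applied with
`θ = Λ'_{b,W} - 1` this is the bound `O(‖Λ_{b,W} - 1‖_{U^k[H]}) + o(1) + O(ε)` of the source.
[cite: TaoTeravainenJTNB2018, §5 (proof of Theorem 3.2, from (targ) to the end)] -/
theorem abs_sum_mul_corrLogAvg_le {k : ℕ} (hk : 1 ≤ k) (h : Fin k → ℕ) {i₀ : Fin k}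
    (hi₀ : h i₀ = 0) {B : ℕ} (hB : ∀ j, h j ≤ B) {a W : ℕ} (ha : 1 ≤ a) (hW : 1 ≤ W) (b x : ℕ)
    (θ : ℕ → ℝ) {H : ℕ} (hH : 1 ≤ H) :
    |∑ d ∈ Icc 1 H, θ d * corrLogAvg h x (a * (W * d + b))| ≤
      ((B + 3 : ℕ) : ℝ) ^ 2 * H * uniformityNorm k H (fun z : ℤ => ((θ z.toNat : ℝ) : ℂ)) +
        4 * ((a * W * H : ℕ) : ℝ) * (∑ d ∈ Icc 1 H, |θ d|) / ∑ ν ∈ Icc 1 x, (1 : ℝ) / ν := by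
  set S : ℝ := ∑ ν ∈ Icc 1 x, (1 : ℝ) / ν with hSdef
  set u : ℝ := uniformityNorm k H (fun z : ℤ => ((θ z.toNat : ℝ) : ℂ)) with hudef
  have hu0 : 0 ≤ u := uniformityNorm_nonneg _ _ _
  set N : ℕ := a * W * H with hNdef
  have hN1 : 1 ≤ N := by rw [hNdef]; exact Nat.one_le_iff_ne_zero.mpr (by positivity)
  have hN0 : (0 : ℝ) < N := by exact_mod_cast hN1
  -- the case `x = 0` (empty average)
  rcases Nat.eq_zero_or_pos x with hx | hx
  · subst hx
    have h0 : ∀ d, corrLogAvg h 0 (a * (W * d + b)) = 0 := fun d => by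
      simp [corrLogAvg, setLogAvg]
    simp only [h0, mul_zero, Finset.sum_const_zero, abs_zero]
    have hS0 : S = 0 := by simp [hSdef]
    rw [hS0, div_zero, add_zero]
    positivity
  have hS : 0 < S := by
    rw [hSdef]
    exact Finset.sum_pos (fun ν hν => by
      have := (Finset.mem_Icc.mp hν).1
      positivity) ⟨1, Finset.mem_Icc.mpr ⟨le_rfl, hx⟩⟩
  -- notation for the integrands
  set G : ℕ → ℕ → ℝ := fun d ν => dilatedCorr h (a * (W * d + b)) ν with hGdef
  have hG1 : ∀ d ν, |G d ν| ≤ 1 := fun d ν => abs_dilatedCorr_le_one _ _ _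
  have hf : ∀ d, corrLogAvg h x (a * (W * d + b)) = (∑ ν ∈ Icc 1 x, G d ν / ν) / S := fun d => rfl
  -- Step A: shift and average in every summand
  set Avg : ℕ → ℝ := fun d => (∑ t ∈ Icc 1 N, ∑ ν ∈ Icc 1 x, G d (ν + t) / ν) / N with hAvg
  have hA : ∀ d, |∑ ν ∈ Icc 1 x, G d ν / ν - Avg d| ≤ 4 * N := fun d =>
    abs_sum_sub_avg_shift_le (hG1 d) hN1 x
  -- Step C: the averaged main term is a sum of GvN configurations
  have hC : |∑ d ∈ Icc 1 H, θ d * Avg d| ≤ S * (((B + 3 : ℕ) : ℝ) ^ 2 * H * u) := by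
    -- rearrange into `(1/N) ∑_ν (1/ν) ∑_t ∑_d θ(d) G_d(ν + t)`
    have hL : ∑ d ∈ Icc 1 H, θ d * Avg d =
        (∑ d ∈ Icc 1 H, ∑ t ∈ Icc 1 N, ∑ ν ∈ Icc 1 x, θ d * G d (ν + t) / ν) / N := by
      simp only [hAvg, mul_div_assoc']
      rw [Finset.sum_div]
      refine Finset.sum_congr rfl fun d _ => ?_
      rw [Finset.mul_sum]
      congr 1
      refine Finset.sum_congr rfl fun t _ => ?_
      rw [Finset.mul_sum]
      exact Finset.sum_congr rfl fun ν _ => by ring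
    have hcomm : ∑ d ∈ Icc 1 H, ∑ t ∈ Icc 1 N, ∑ ν ∈ Icc 1 x, θ d * G d (ν + t) / ν =
        ∑ ν ∈ Icc 1 x, (1 / (ν : ℝ)) * ∑ t ∈ Icc 1 N, ∑ d ∈ Icc 1 H, θ d * G d (ν + t) := by
      rw [Finset.sum_comm]
      have h1 : ∀ t ∈ Icc 1 N, ∑ d ∈ Icc 1 H, ∑ ν ∈ Icc 1 x, θ d * G d (ν + t) / ν =
          ∑ ν ∈ Icc 1 x, ∑ d ∈ Icc 1 H, θ d * G d (ν + t) / ν := fun t _ => Finset.sum_comm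
      rw [Finset.sum_congr rfl h1, Finset.sum_comm]
      refine Finset.sum_congr rfl fun ν _ => ?_
      rw [Finset.mul_sum]
      refine Finset.sum_congr rfl fun t _ => ?_
      rw [Finset.mul_sum]
      exact Finset.sum_congr rfl fun d _ => by ring
    have hre : ∑ d ∈ Icc 1 H, θ d * Avg d =
        (∑ ν ∈ Icc 1 x, (1 / (ν : ℝ)) * ∑ t ∈ Icc 1 N, ∑ d ∈ Icc 1 H, θ d * G d (ν + t)) / N := by
      rw [hL, hcomm]
    rw [hre, abs_div, Nat.abs_cast, div_le_iff₀ hN0]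
    -- bound each `ν`-term
    have hinner : ∀ ν : ℕ, |∑ t ∈ Icc 1 N, ∑ d ∈ Icc 1 H, θ d * G d (ν + t)| ≤
        (a * W : ℕ) * ((((B + 3) * H : ℕ) : ℝ) ^ 2 * u) := by
      intro ν
      rw [hNdef, sum_Icc_mul_eq_sum_sum _ (a * W) H, Finset.sum_comm]
      refine (Finset.abs_sum_le_sum_abs _ _).trans ?_
      have hcard : ((Icc 1 (a * W)).card : ℝ) = (a * W : ℕ) := by simp
      rw [← hcard, ← nsmul_eq_mul, ← Finset.sum_const]
      refine Finset.sum_le_sum fun c _ => ?_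
      -- the GvN configuration for fixed `c, ν`
      set φ : Fin k → ℕ → ℝ := fun j t =>
        (ArithmeticFunction.liouville (ν + c + a * b * h j + a * W * (t - 1)) : ℝ) with hφ
      have hφ1 : ∀ j t, |φ j t| ≤ 1 := fun j t =>
        Literature.NumberTheory.LFunctions.LiouvilleSum.abs_liouville_le_one _
      have hsum : ∑ n'' ∈ Finset.range H, ∑ d ∈ Icc 1 H, θ d * G d (ν + (a * W * n'' + c)) =
          ∑ d ∈ Icc 1 H, ∑ n ∈ Icc 1 H,
            (fun z : ℤ => θ z.toNat) d * ∏ j, φ j (n + h j * d) := by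
        rw [Finset.sum_comm]
        refine Finset.sum_congr rfl fun d _ => ?_
        rw [← sum_range_succ_eq_sum_Icc]
        refine Finset.sum_congr rfl fun n'' _ => ?_
        simp only [Int.toNat_natCast, hGdef, hφ]
        rw [dilatedCorr_shift_eq]
      rw [hsum]
      exact abs_sum_dilated_le hk h hi₀ hB (fun z : ℤ => θ z.toNat) hφ1 hH
    calc |∑ ν ∈ Icc 1 x, 1 / (ν : ℝ) * ∑ t ∈ Icc 1 N, ∑ d ∈ Icc 1 H, θ d * G d (ν + t)|
        ≤ ∑ ν ∈ Icc 1 x, |1 / (ν : ℝ) * ∑ t ∈ Icc 1 N, ∑ d ∈ Icc 1 H, θ d * G d (ν + t)| :=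
          Finset.abs_sum_le_sum_abs _ _
      _ ≤ ∑ ν ∈ Icc 1 x, 1 / (ν : ℝ) * ((a * W : ℕ) * ((((B + 3) * H : ℕ) : ℝ) ^ 2 * u)) :=
          Finset.sum_le_sum fun ν _ => by
            rw [abs_mul, abs_of_nonneg (by positivity : (0 : ℝ) ≤ 1 / ν)]
            exact mul_le_mul_of_nonneg_left (hinner ν) (by positivity)
      _ = S * (((B + 3 : ℕ) : ℝ) ^ 2 * H * u) * N := by
          rw [← Finset.sum_mul, ← hSdef, hNdef]; push_cast; ring
  -- Step B: assemble
  have hsplit : ∑ d ∈ Icc 1 H, θ d * corrLogAvg h x (a * (W * d + b)) =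
      ((∑ d ∈ Icc 1 H, θ d * Avg d) +
        ∑ d ∈ Icc 1 H, θ d * (∑ ν ∈ Icc 1 x, G d ν / ν - Avg d)) / S := by
    rw [← Finset.sum_add_distrib, Finset.sum_div]
    refine Finset.sum_congr rfl fun d _ => ?_
    rw [hf d]; ring
  have hR : |∑ d ∈ Icc 1 H, θ d * (∑ ν ∈ Icc 1 x, G d ν / ν - Avg d)| ≤
      4 * ((a * W * H : ℕ) : ℝ) * ∑ d ∈ Icc 1 H, |θ d| := by
    refine (Finset.abs_sum_le_sum_abs _ _).trans ?_
    rw [Finset.mul_sum]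
    refine Finset.sum_le_sum fun d _ => ?_
    rw [abs_mul]
    calc |θ d| * |∑ ν ∈ Icc 1 x, G d ν / ν - Avg d| ≤ |θ d| * (4 * N) :=
          mul_le_mul_of_nonneg_left (hA d) (abs_nonneg _)
      _ = 4 * ((a * W * H : ℕ) : ℝ) * |θ d| := by rw [hNdef]; ring
  rw [hsplit, abs_div, abs_of_pos hS, div_le_iff₀ hS, add_mul, div_mul_cancel₀ _ hS.ne']
  calc |(∑ d ∈ Icc 1 H, θ d * Avg d) + ∑ d ∈ Icc 1 H, θ d * (∑ ν ∈ Icc 1 x, G d ν / ν - Avg d)|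
      ≤ |∑ d ∈ Icc 1 H, θ d * Avg d| + |∑ d ∈ Icc 1 H, θ d * (∑ ν ∈ Icc 1 x, G d ν / ν - Avg d)| :=
        abs_add_le _ _
    _ ≤ S * (((B + 3 : ℕ) : ℝ) ^ 2 * H * u) + 4 * ((a * W * H : ℕ) : ℝ) * ∑ d ∈ Icc 1 H, |θ d| :=
        add_le_add hC hR
    _ = ((B + 3 : ℕ) : ℝ) ^ 2 * H * u * S + 4 * ((a * W * H : ℕ) : ℝ) * ∑ d ∈ Icc 1 H, |θ d| := by
        ring

end OddLogChowla

end Literature.NumberTheory.Sieve
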